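import Literature.Analysis.FluidPDE.SchefferTestFunction
import Literature.Analysis.FluidPDE.BackwardHeatSubsolution
import Literature.Analysis.FluidPDE.EssCurry
import Literature.Analysis.Calculus.SmoothCutoff
import HarnessLib

/-!
# A localised forward Gaussian test function for the backward heat inequality

Analysis/FluidPDE support file (definitions of auxiliary test functions + theorems) for the
discharge of the named fact `Literature.Analysis.FluidPDE.Carleman.seregin_backwardHeat_sup_le_L2`
(`FluidPDE/BackwardHeatRegularity`: Seregin 2014, App. A.2, (A.2.18), the local `L∞–L²` estimate
`|v(x₀, 1/2)|² ≤ c₉ ∫_{]1/2,1[×B(x₀,1)} |v|²` for functions with `|∂ₜv + Δv| ≤ c₁(|∇v| + |v|)`,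
quoted there from the regularity theory of parabolic equations, LSU 1968). The weak subsolution
inequality `∫ (∂ₜG - ΔG - C₀G)|v|² ≤ 0` of `FluidPDE/BackwardHeatSubsolution` is tested with the
classical duality test function (LSU 1968, Ch. III §8; Lieberman 1996, Ch. VI §6): a **forward**
heat kernel started slightly before the point `(1/2, x₀)`, cut off in space and switched on and
off smoothly in time,

  `G(t, x) = ρ_δ(t) θ(t) e^{C₀t} φ(x₀ - x) Γ(t - 1/2 + ε, x₀ - x)`,

where `Γ = UnboundedOperators.heatKernel` is the Gauss–Weierstrass kernel, `φ = Scheffer.spaceCut 1`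
(`= 1` on `B̄(0, 1/2)`, `= 0` off `B(0, 5/8)`), `ρ_δ(t) = smoothTransition((t - 1/2)/δ)` rises
from `0` to `1` on `[1/2, 1/2 + δ]` and `θ(t) = smoothTransition(4(1 - t))` falls from `1` to `0`
on `[3/4, 1]`. Since `Γ` solves the heat equation, the frame heat operator of
`FluidPDE/CarlemanCalculus` applied to `G` is (`dt_sub_lap_heatTest`)

  `∂ₜG - ΔₓG - C₀G = (ρ_δ θ)' e^{C₀t} φΓ - ρ_δ θ e^{C₀t} R`,  `R = Γ Δφ + 2 ∇φ·∇Γ`,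

where the remainder `R` lives on the annulus `1/2 ≤ |x₀ - x| ≤ 5/8`, on which `Γ` and `∇Γ` are
bounded uniformly in time (`Scheffer.exists_heatKernel_le_div_pow`,
`Scheffer.exists_norm_fderiv_heatKernel_le_div_pow`). This file records `G`, its smoothness,
support (`⊆ [1/2, 1] × B̄(x₀, 5/8)`), sign, the above identity, and the bounds on its pieces:
the positive part `ρ_δ' e^{C₀t} φΓ` (concentrating at `(1/2, x₀)` as `δ, ε → 0`) and the bounded
part `θ' e^{C₀t} φΓ - ρ_δθ e^{C₀t} R`, supported in `]1/2, 1[ × B(x₀, 1)`.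

## References

* G. Seregin, *Lecture notes on regularity theory for the Navier–Stokes equations*, World
  Scientific 2014, App. A.2 (A.2.18), p. 210. [Seregin2014]
* O. A. Ladyženskaja, V. A. Solonnikov, N. N. Ural′ceva, *Linear and quasi-linear equations of
  parabolic type*, AMS 1968, Ch. III §8, Ch. IV §1 (fundamental solution).
* L. C. Evans, *Partial Differential Equations*, 2nd ed. 2010, §2.3.1 (`Φₜ = ΔΦ`).
-/

noncomputable section

open MeasureTheory Filter Topology Set InnerProductSpace Metric Function
open scoped Real NNReal RealInnerProductSpace Laplacian ContDiff

namespace Literature.Analysis.FluidPDE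

namespace Carleman

open UnboundedOperators Scheffer Literature.Analysis.Calculus

/-! ### The frame Laplacian of a global `C²` function is the Laplacian of its slices -/

section Bridge

variable {E : Type*} [NormedAddCommGroup E] [InnerProductSpace ℝ E] [FiniteDimensional ℝ E]

/-- `ΔₓH(t, x)` (frame Laplacian of `FluidPDE/CarlemanCalculus`) is Mathlib's Laplacian of the
space slice `y ↦ H(t, y)`, for `H : ℝ × E → ℝ` of class `C²` on `ℝ × E` (the global case of
`Carleman.lap_uncurry`, via the dictionary `fderiv_apply_zero_eq_fderiv_slice` of
`FluidPDE/EssCurry`). [folklore] -/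
theorem lap_eq_laplacian_slice {H : ℝ × E → ℝ} (hH : ContDiff ℝ 2 H) (t : ℝ) (x : E) :
    lap H (t, x) = (Δ (fun y => H (t, y))) x := by
  set b := stdOrthonormalBasis ℝ E with hb
  have hs : ContDiff ℝ 2 (fun y => H (t, y)) := hH.comp (contDiff_const.prodMk contDiff_id)
  rw [laplacian_eq_sum_fderiv_fderiv b hs x, lap]
  refine Finset.sum_congr rfl fun i _ => ?_
  have hd1 : ∀ y, DifferentiableAt ℝ H (t, y) := fun y => hH.differentiable (by norm_num) _
  have hdx : ContDiff ℝ 1 (dx (b i) H) :=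
    (hH.fderiv_right (m := 1) le_rfl).clm_apply contDiff_const
  have hd2 : DifferentiableAt ℝ (dx (b i) H) (t, x) := hdx.differentiable one_ne_zero _
  rw [dx_apply, fderiv_apply_zero_eq_fderiv_slice hd2]
  have hfun : (fun y => dx (b i) H (t, y)) = fun y => fderiv ℝ (fun y => H (t, y)) y (b i) :=
    funext fun y => by rw [dx_apply, fderiv_apply_zero_eq_fderiv_slice (hd1 y)]
  rw [hfun]

end Bridge

/-! ### The time profiles `ρ_δ` (rise) and `θ` (fall) -/

section Time

/-- The rise `ρ_δ(t) = smoothTransition((t - 1/2)/δ)`: smooth, `= 0` for `t ≤ 1/2`, `= 1` for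
`t ≥ 1/2 + δ`, monotone. [folklore] -/
def rise (δ t : ℝ) : ℝ := Real.smoothTransition ((t - 1 / 2) / δ)

/-- The fall `θ(t) = smoothTransition(4(1 - t))`: smooth, `= 1` for `t ≤ 3/4`, `= 0` for
`t ≥ 1`. [folklore] -/
def fall (t : ℝ) : ℝ := Real.smoothTransition (4 * (1 - t))

/-- `ρ_δ` is smooth. [folklore] -/
theorem contDiff_rise {m : ℕ∞} (δ : ℝ) : ContDiff ℝ m (rise δ) :=
  Real.smoothTransition.contDiff.comp ((contDiff_id.sub contDiff_const).div_const _)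

/-- `θ` is smooth. [folklore] -/
theorem contDiff_fall {m : ℕ∞} : ContDiff ℝ m fall :=
  Real.smoothTransition.contDiff.comp (contDiff_const.mul (contDiff_const.sub contDiff_id))

/-- `0 ≤ ρ_δ`. [folklore] -/
theorem rise_nonneg (δ t : ℝ) : 0 ≤ rise δ t := Real.smoothTransition.nonneg _

/-- `ρ_δ ≤ 1`. [folklore] -/
theorem rise_le_one (δ t : ℝ) : rise δ t ≤ 1 := Real.smoothTransition.le_one _

/-- `0 ≤ θ`. [folklore] -/
theorem fall_nonneg (t : ℝ) : 0 ≤ fall t := Real.smoothTransition.nonneg _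

/-- `θ ≤ 1`. [folklore] -/
theorem fall_le_one (t : ℝ) : fall t ≤ 1 := Real.smoothTransition.le_one _

/-- `ρ_δ(t) = 0` for `t ≤ 1/2` (`δ > 0`). [folklore] -/
theorem rise_eq_zero {δ t : ℝ} (hδ : 0 < δ) (ht : t ≤ 1 / 2) : rise δ t = 0 :=
  Real.smoothTransition.zero_of_nonpos (div_nonpos_of_nonpos_of_nonneg (by linarith) hδ.le)

/-- `ρ_δ(t) = 1` for `t ≥ 1/2 + δ` (`δ > 0`). [folklore] -/
theorem rise_eq_one {δ t : ℝ} (hδ : 0 < δ) (ht : 1 / 2 + δ ≤ t) : rise δ t = 1 :=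
  Real.smoothTransition.one_of_one_le (by rw [le_div_iff₀ hδ]; linarith)

/-- `θ(t) = 1` for `t ≤ 3/4`. [folklore] -/
theorem fall_eq_one {t : ℝ} (ht : t ≤ 3 / 4) : fall t = 1 :=
  Real.smoothTransition.one_of_one_le (by linarith)

/-- `θ(t) = 0` for `t ≥ 1`. [folklore] -/
theorem fall_eq_zero {t : ℝ} (ht : 1 ≤ t) : fall t = 0 :=
  Real.smoothTransition.zero_of_nonpos (by linarith)

/-- The derivative of the rise: `ρ_δ'(t) = δ⁻¹ S'((t - 1/2)/δ)`, `S = smoothTransition`. [folklore] -/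
theorem hasDerivAt_rise (δ t : ℝ) :
    HasDerivAt (rise δ) (deriv Real.smoothTransition ((t - 1 / 2) / δ) * (1 / δ)) t := by
  have hin : HasDerivAt (fun s : ℝ => (s - 1 / 2) / δ) (1 / δ) t := by
    simpa using ((hasDerivAt_id t).sub_const (1 / 2 : ℝ)).div_const δ
  have hout : HasDerivAt Real.smoothTransition (deriv Real.smoothTransition ((t - 1 / 2) / δ))
      ((t - 1 / 2) / δ) := (differentiable_smoothTransition _).hasDerivAt
  exact hout.comp t hin

/-- The derivative of the fall: `θ'(t) = -4 S'(4(1 - t))`. [folklore] -/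
theorem hasDerivAt_fall (t : ℝ) :
    HasDerivAt fall (deriv Real.smoothTransition (4 * (1 - t)) * (-4)) t := by
  have hin : HasDerivAt (fun s : ℝ => 4 * (1 - s)) (-4) t := by
    simpa using ((hasDerivAt_const t (1 : ℝ)).sub (hasDerivAt_id t)).const_mul (4 : ℝ)
  have hout : HasDerivAt Real.smoothTransition (deriv Real.smoothTransition (4 * (1 - t)))
      (4 * (1 - t)) := (differentiable_smoothTransition _).hasDerivAt
  exact hout.comp t hin

/-- `ρ_δ' = δ⁻¹ S'((t - 1/2)/δ)`. [folklore] -/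
theorem deriv_rise (δ t : ℝ) :
    deriv (rise δ) t = deriv Real.smoothTransition ((t - 1 / 2) / δ) * (1 / δ) :=
  (hasDerivAt_rise δ t).deriv

/-- `θ' = -4 S'(4(1 - t))`. [folklore] -/
theorem deriv_fall (t : ℝ) : deriv fall t = deriv Real.smoothTransition (4 * (1 - t)) * (-4) :=
  (hasDerivAt_fall t).deriv

/-- `ρ_δ' ≥ 0` (`δ > 0`; the smooth transition is monotone). [folklore] -/
theorem deriv_rise_nonneg {δ : ℝ} (hδ : 0 < δ) (t : ℝ) : 0 ≤ deriv (rise δ) t := by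
  rw [deriv_rise]
  exact mul_nonneg Real.smoothTransition.monotone.deriv_nonneg (by positivity)

/-- `ρ_δ'(t) = 0` for `t ≤ 1/2` (`δ > 0`). [folklore] -/
theorem deriv_rise_eq_zero_of_le {δ t : ℝ} (hδ : 0 < δ) (ht : t ≤ 1 / 2) : deriv (rise δ) t = 0 := by
  rw [deriv_rise, deriv_smoothTransition_of_nonpos
    (div_nonpos_of_nonpos_of_nonneg (by linarith) hδ.le), zero_mul]

/-- `ρ_δ'(t) = 0` for `t ≥ 1/2 + δ` (`δ > 0`). [folklore] -/
theorem deriv_rise_eq_zero_of_ge {δ t : ℝ} (hδ : 0 < δ) (ht : 1 / 2 + δ ≤ t) :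
    deriv (rise δ) t = 0 := by
  rw [deriv_rise, deriv_smoothTransition_of_one_le (by rw [le_div_iff₀ hδ]; linarith), zero_mul]

/-- `θ'(t) = 0` for `t ≤ 3/4`. [folklore] -/
theorem deriv_fall_eq_zero_of_le {t : ℝ} (ht : t ≤ 3 / 4) : deriv fall t = 0 := by
  rw [deriv_fall, deriv_smoothTransition_of_one_le (by linarith), zero_mul]

/-- `θ'(t) = 0` for `t ≥ 1`. [folklore] -/
theorem deriv_fall_eq_zero_of_ge {t : ℝ} (ht : 1 ≤ t) : deriv fall t = 0 := by
  rw [deriv_fall, deriv_smoothTransition_of_nonpos (by linarith), zero_mul]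

/-- A universal bound `|θ'| ≤ D`. [folklore] -/
theorem exists_abs_deriv_fall_le : ∃ D : ℝ, 0 ≤ D ∧ ∀ t, |deriv fall t| ≤ D := by
  obtain ⟨D, hD0, hD⟩ := exists_bound_deriv_smoothTransition
  refine ⟨4 * D, by positivity, fun t => ?_⟩
  rw [deriv_fall, abs_mul]
  have := hD (4 * (1 - t))
  have h4 : |(-4 : ℝ)| = 4 := by norm_num
  rw [h4]
  nlinarith [abs_nonneg (deriv Real.smoothTransition (4 * (1 - t)))]

/-- For `0 < δ ≤ 1/4` the product rule collapses: `(ρ_δ θ)' = ρ_δ' + θ'` (where `ρ_δ' ≠ 0` the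
fall is `1`, where `θ' ≠ 0` the rise is `1`). [folklore] -/
theorem deriv_rise_mul_fall {δ : ℝ} (hδ : 0 < δ) (hδ4 : δ ≤ 1 / 4) (t : ℝ) :
    deriv (fun s => rise δ s * fall s) t = deriv (rise δ) t + deriv fall t := by
  have h : HasDerivAt (fun s => rise δ s * fall s)
      (deriv Real.smoothTransition ((t - 1 / 2) / δ) * (1 / δ) * fall t +
        rise δ t * (deriv Real.smoothTransition (4 * (1 - t)) * (-4))) t :=
    (hasDerivAt_rise δ t).mul (hasDerivAt_fall t)
  rw [h.deriv, ← deriv_rise, ← deriv_fall]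
  rcases le_or_gt t (3 / 4) with h | h
  · rw [fall_eq_one h, deriv_fall_eq_zero_of_le h]
    ring
  · rw [rise_eq_one hδ (by linarith), deriv_rise_eq_zero_of_ge hδ (by linarith)]
    ring

/-- `∫_{1/2}^{1/2+δ} ρ_δ' = 1`. [folklore] -/
theorem integral_deriv_rise {δ : ℝ} (hδ : 0 < δ) :
    ∫ t in (1 / 2 : ℝ)..(1 / 2 + δ), deriv (rise δ) t = 1 := by
  rw [intervalIntegral.integral_deriv_eq_sub (fun t _ => (hasDerivAt_rise δ t).differentiableAt)
    (((contDiff_rise (m := 1) δ).continuous_deriv le_rfl).intervalIntegrable _ _),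
    rise_eq_one hδ le_rfl, rise_eq_zero hδ le_rfl]
  norm_num

end Time

/-! ### The spatial factor `K_s = φ Γ_s` and the remainder `R_s = Γ_s Δφ + 2 ∇φ·∇Γ_s` -/

section Space

variable {E : Type*} [NormedAddCommGroup E] [InnerProductSpace ℝ E] [FiniteDimensional ℝ E]

/-- The spatial factor `K_s(y) = φ(y) Γ_s(y)`: the Gauss–Weierstrass kernel at time `s` cut off
by `φ = Scheffer.spaceCut 1` (`= 1` on `B̄(0, 1/2)`, `= 0` off `B(0, 5/8)`). [folklore] -/
def spaceKernel (s : ℝ) (y : E) : ℝ := spaceCut 1 y * heatKernel s y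

/-- The remainder of the heat operator on `K_s`: `R_s(y) = Γ_s(y) Δφ(y) + 2 Σᵢ ∂ᵢφ(y) ∂ᵢΓ_s(y)`,
so that `ΔK_s = φ ΔΓ_s + R_s`. [folklore] -/
def kernelRem (s : ℝ) (y : E) : ℝ :=
  heatKernel s y * (Δ (spaceCut (E := E) 1)) y +
    2 * ∑ i, fderiv ℝ (spaceCut (E := E) 1) y (stdOrthonormalBasis ℝ E i) *
      fderiv ℝ (heatKernel s) y (stdOrthonormalBasis ℝ E i)

/-- Unfolding `spaceKernel`. [folklore] -/
theorem spaceKernel_def (s : ℝ) :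
    spaceKernel (E := E) s = fun y => spaceCut 1 y * heatKernel s y := rfl

/-- `K_s` is smooth in space (every `s`, junk times included). [folklore] -/
theorem contDiff_spaceKernel {m : ℕ∞} (s : ℝ) : ContDiff ℝ m (spaceKernel (E := E) s) :=
  (contDiff_spaceCut 1).mul (contDiff_heatKernel s)

/-- `K_s ≥ 0` for `s > 0`. [folklore] -/
theorem spaceKernel_nonneg {s : ℝ} (hs : 0 < s) (y : E) : 0 ≤ spaceKernel s y :=
  mul_nonneg (spaceCut_nonneg _ _) (heatKernel_pos hs y).le

/-- `K_s ≤ Γ_s` for `s > 0`. [folklore] -/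
theorem spaceKernel_le_heatKernel {s : ℝ} (hs : 0 < s) (y : E) :
    spaceKernel s y ≤ heatKernel s y :=
  mul_le_of_le_one_left (heatKernel_pos hs y).le (spaceCut_le_one _ _)

/-- `K_s ≤ 1` for `s ≥ 1/4` (peak bound `Γ_s ≤ (4πs)^{-n/2} ≤ π^{-n/2} ≤ 1`). [folklore] -/
theorem spaceKernel_le_one {s : ℝ} (hs : 1 / 4 ≤ s) (y : E) : spaceKernel s y ≤ 1 := by
  have hs0 : 0 < s := by linarith
  refine (spaceKernel_le_heatKernel hs0 y).trans ?_
  refine (heatKernel_le_peak (by norm_num : (0 : ℝ) < 1 / 4) hs y).trans ?_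
  rw [show 4 * π * (1 / 4) = π by ring]
  refine Real.rpow_le_one_of_one_le_of_nonpos ?_ ?_
  · linarith [Real.pi_gt_three]
  · have : (0 : ℝ) ≤ Module.finrank ℝ E := Nat.cast_nonneg _
    linarith [div_nonneg this zero_le_two]

/-- `K_s(y) ≠ 0` forces `‖y‖ < 5/8`. [folklore] -/
theorem norm_lt_of_spaceKernel_ne_zero {s : ℝ} {y : E} (h : spaceKernel s y ≠ 0) :
    ‖y‖ < 5 / 8 := by
  have h1 : spaceCut (E := E) 1 y ≠ 0 := fun h0 => h (by simp [spaceKernel, h0])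
  have := norm_lt_of_spaceCut_ne_zero one_pos h1
  linarith

/-- `K_s = Γ_s` on `B̄(0, 1/2)`. [folklore] -/
theorem spaceKernel_eq_heatKernel {s : ℝ} {y : E} (hy : ‖y‖ ≤ 1 / 2) :
    spaceKernel s y = heatKernel s y := by
  rw [spaceKernel, spaceCut_eq_one one_pos (by linarith), one_mul]

/-- **The Laplacian of the spatial factor**: `ΔK_s = φ · (‖y‖²/(4s²) - n/(2s)) Γ_s + R_s`
(Leibniz rule for `Δ` and the closed form of `ΔΓ_s`). [folklore] -/
theorem laplacian_spaceKernel (s : ℝ) (y : E) :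
    (Δ (spaceKernel (E := E) s)) y =
      spaceCut 1 y * ((‖y‖ ^ 2 / (4 * s ^ 2) - (Module.finrank ℝ E : ℝ) / (2 * s)) *
        heatKernel s y) + kernelRem s y := by
  rw [spaceKernel_def, laplacian_mul_eq (stdOrthonormalBasis ℝ E) (contDiff_spaceCut 1)
    (contDiff_heatKernel s) y, laplacian_heatKernel, kernelRem]
  ring

/-- **The remainder is bounded uniformly in time and lives on the annulus**: there is
`K = K(n) ≥ 0` with `|R_s(y)| ≤ K` for all `s > 0`, `y`, and `R_s(y) ≠ 0 ⟹ 1/2 ≤ ‖y‖ ≤ 5/8`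
(off-diagonal Gaussian bounds on the support of `∇φ`, `Δφ`). [folklore] -/
theorem exists_abs_kernelRem_le :
    ∃ K : ℝ, 0 ≤ K ∧ ∀ s : ℝ, 0 < s → ∀ y : E,
      |kernelRem s y| ≤ K ∧ (kernelRem s y ≠ 0 → 1 / 2 ≤ ‖y‖ ∧ ‖y‖ ≤ 5 / 8) := by
  obtain ⟨M₁, hM₁0, hM₁⟩ := exists_norm_fderiv_spaceCut_le (E := E)
  obtain ⟨M₂, hM₂0, hM₂⟩ := exists_abs_laplacian_spaceCut_le (E := E)
  obtain ⟨C₀, hC₀0, hC₀⟩ := exists_heatKernel_le_div_pow (E := E)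
  obtain ⟨C₁, hC₁0, hC₁⟩ := exists_norm_fderiv_heatKernel_le_div_pow (E := E)
  set n := Module.finrank ℝ E with hn
  set b := stdOrthonormalBasis ℝ E with hb
  refine ⟨C₀ / (1 / 2) ^ n * M₂ + 2 * (M₁ * (C₁ / (1 / 2) ^ (n + 1))), by positivity,
    fun s hs y => ?_⟩
  have hG0 : 0 ≤ heatKernel s y := (heatKernel_pos hs y).le
  -- the Laplacian term
  have hA : |heatKernel s y * (Δ (spaceCut (E := E) 1)) y| ≤ C₀ / (1 / 2) ^ n * M₂ := by
    rcases eq_or_ne ((Δ (spaceCut (E := E) 1)) y) 0 with h0 | h0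
    · rw [h0, mul_zero, abs_zero]; positivity
    · obtain ⟨hy1, -⟩ := (hM₂ 1 one_pos y).2 h0
      rw [abs_mul, abs_of_nonneg hG0]
      have h1 := hC₀ s (1 / 2) y hs (by norm_num) (by linarith)
      have h2 := (hM₂ 1 one_pos y).1
      rw [one_pow, div_one] at h2
      exact mul_le_mul h1 h2 (abs_nonneg _) (by positivity)
  -- the gradient term
  have hB : |∑ i, fderiv ℝ (spaceCut (E := E) 1) y (b i) * fderiv ℝ (heatKernel s) y (b i)| ≤
      M₁ * (C₁ / (1 / 2) ^ (n + 1)) := by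
    have hCS := abs_sum_fderiv_mul_fderiv_le b (spaceCut (E := E) 1) (heatKernel s) y
    rcases eq_or_ne (fderiv ℝ (spaceCut (E := E) 1) y) 0 with h0 | h0
    · refine hCS.trans ?_
      rw [h0, norm_zero, zero_mul]; positivity
    · obtain ⟨hy1, -⟩ := (hM₁ 1 one_pos y).2 h0
      have h1 := hC₁ s (1 / 2) y hs (by norm_num) (by linarith)
      have h2 := (hM₁ 1 one_pos y).1
      rw [div_one] at h2
      exact hCS.trans (mul_le_mul h2 h1 (norm_nonneg _) hM₁0)
  refine ⟨?_, fun hne => ?_⟩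
  · rw [kernelRem]
    refine (abs_add_le _ _).trans (add_le_add hA ?_)
    rw [abs_mul, abs_two]
    exact mul_le_mul_of_nonneg_left hB zero_le_two
  · -- support
    by_contra hcon
    apply hne
    have h1 : (Δ (spaceCut (E := E) 1)) y = 0 := by
      by_contra h0
      obtain ⟨hy1, hy2⟩ := (hM₂ 1 one_pos y).2 h0
      exact hcon ⟨hy1, by linarith⟩
    have h2 : fderiv ℝ (spaceCut (E := E) 1) y = 0 := by
      by_contra h0
      obtain ⟨hy1, hy2⟩ := (hM₁ 1 one_pos y).2 h0
      exact hcon ⟨hy1, by linarith⟩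
    simp [kernelRem, h1, h2, ← hb]

/-- `R_s` is jointly continuous on `s > 0`. [folklore] -/
theorem continuousOn_kernelRem :
    ContinuousOn (fun p : ℝ × E => kernelRem p.1 p.2) (Ioi (0 : ℝ) ×ˢ univ) := by
  have h2 : ContDiff ℝ 2 (spaceCut (E := E) 1) := contDiff_spaceCut 1
  have hK : ContDiffOn ℝ 1 (fun p : ℝ × E => heatKernel p.1 p.2) (Ioi (0 : ℝ) ×ˢ univ) :=
    contDiffOn_uncurry_heatKernel
  have hopen : IsOpen (Ioi (0 : ℝ) ×ˢ (univ : Set E)) := isOpen_Ioi.prod isOpen_univ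
  -- the spatial gradient of the kernel, jointly continuous
  have hgrad : ∀ v : E, ContinuousOn (fun p : ℝ × E => fderiv ℝ (heatKernel p.1) p.2 v)
      (Ioi (0 : ℝ) ×ˢ univ) := by
    intro v
    have hd : ContinuousOn (fun p : ℝ × E => fderiv ℝ (fun p : ℝ × E => heatKernel p.1 p.2) p)
        (Ioi (0 : ℝ) ×ˢ univ) := hK.continuousOn_fderiv_of_isOpen hopen le_rfl
    have heq : ∀ p ∈ Ioi (0 : ℝ) ×ˢ (univ : Set E), fderiv ℝ (heatKernel p.1) p.2 v =
        fderiv ℝ (fun p : ℝ × E => heatKernel p.1 p.2) p (0, v) := by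
      intro p hp
      have hdiff : DifferentiableAt ℝ (fun p : ℝ × E => heatKernel p.1 p.2) p :=
        (hK.differentiableOn one_ne_zero p hp).differentiableAt (hopen.mem_nhds hp)
      exact (fderiv_apply_zero_eq_fderiv_slice (G := fun p : ℝ × E => heatKernel p.1 p.2)
        (t := p.1) (x := p.2) hdiff v).symm
    exact ((hd.clm_apply continuousOn_const).congr heq)
  refine ContinuousOn.add ?_ ?_
  · exact hK.continuousOn.mul ((continuous_laplacian h2).comp continuous_snd).continuousOn
  · refine continuousOn_const.mul (continuousOn_finsetSum _ fun i _ => ?_)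
    exact ((((h2.continuous_fderiv two_ne_zero).comp continuous_snd).clm_apply
      continuous_const).continuousOn).mul (hgrad _)

end Space

/-! ### The test function `G = ρ_δ θ e^{c₀t} · K_{t-1/2+ε}(x₀ - x)` -/

section TestFn

variable {E : Type*} [NormedAddCommGroup E] [InnerProductSpace ℝ E] [FiniteDimensional ℝ E]

/-- The time profile `A(t) = ρ_δ(t) θ(t) e^{c₀t}`. [folklore] -/
def timeProfile (c₀ δ t : ℝ) : ℝ := rise δ t * fall t * Real.exp (c₀ * t)

/-- **The duality test function** `G(t, x) = ρ_δ(t) θ(t) e^{c₀t} φ(x₀ - x) Γ(t - 1/2 + ε, x₀ - x)`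
(LSU 1968, Ch. III §8: a forward fundamental solution with pole just below the point
`(1/2, x₀)`, localised by cut-offs), as an uncurried function on `ℝ × E`. [folklore] -/
def heatTest (c₀ ε δ : ℝ) (x₀ : E) (z : ℝ × E) : ℝ :=
  timeProfile c₀ δ z.1 * spaceKernel (z.1 - 1 / 2 + ε) (x₀ - z.2)

/-- The **positive part** of `∂ₜG - ΔG - c₀G`: `ρ_δ'(t) e^{c₀t} K_{t-1/2+ε}(x₀ - x)`. [folklore] -/
def heatTestPos (c₀ ε δ : ℝ) (x₀ : E) (z : ℝ × E) : ℝ :=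
  deriv (rise δ) z.1 * Real.exp (c₀ * z.1) * spaceKernel (z.1 - 1 / 2 + ε) (x₀ - z.2)

/-- The **bounded part** of `∂ₜG - ΔG - c₀G`:
`θ'(t) e^{c₀t} K_{t-1/2+ε}(x₀ - x) - A(t) R_{t-1/2+ε}(x₀ - x)`. [folklore] -/
def heatTestRem (c₀ ε δ : ℝ) (x₀ : E) (z : ℝ × E) : ℝ :=
  deriv fall z.1 * Real.exp (c₀ * z.1) * spaceKernel (z.1 - 1 / 2 + ε) (x₀ - z.2) -
    timeProfile c₀ δ z.1 * kernelRem (z.1 - 1 / 2 + ε) (x₀ - z.2)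

omit [FiniteDimensional ℝ E] in
/-- `A ≥ 0`. [folklore] -/
theorem timeProfile_nonneg (c₀ δ t : ℝ) : 0 ≤ timeProfile c₀ δ t :=
  mul_nonneg (mul_nonneg (rise_nonneg _ _) (fall_nonneg _)) (Real.exp_pos _).le

/-- `A(t) ≤ e^{c₀t}`. [folklore] -/
theorem timeProfile_le_exp (c₀ δ t : ℝ) : timeProfile c₀ δ t ≤ Real.exp (c₀ * t) :=
  mul_le_of_le_one_left (Real.exp_pos _).le
    (mul_le_one₀ (rise_le_one _ _) (fall_nonneg _) (fall_le_one _))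

/-- `A(t) = 0` for `t ≤ 1/2`. [folklore] -/
theorem timeProfile_eq_zero_of_le {c₀ δ t : ℝ} (hδ : 0 < δ) (ht : t ≤ 1 / 2) :
    timeProfile c₀ δ t = 0 := by
  simp [timeProfile, rise_eq_zero hδ ht]

/-- `A(t) = 0` for `t ≥ 1`. [folklore] -/
theorem timeProfile_eq_zero_of_ge {c₀ δ t : ℝ} (ht : 1 ≤ t) : timeProfile c₀ δ t = 0 := by
  simp [timeProfile, fall_eq_zero ht]

/-- `A(t) ≠ 0` forces `1/2 < t < 1`. [folklore] -/
theorem timeProfile_ne_zero_imp {c₀ δ t : ℝ} (hδ : 0 < δ) (h : timeProfile c₀ δ t ≠ 0) :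
    1 / 2 < t ∧ t < 1 :=
  ⟨lt_of_not_ge fun h' => h (timeProfile_eq_zero_of_le hδ h'),
    lt_of_not_ge fun h' => h (timeProfile_eq_zero_of_ge h')⟩

/-- `A` is smooth. [folklore] -/
theorem contDiff_timeProfile (c₀ δ : ℝ) : ContDiff ℝ ∞ (timeProfile c₀ δ) :=
  ((contDiff_rise δ).mul contDiff_fall).mul (Real.contDiff_exp.comp (contDiff_const.mul contDiff_id))

/-- `A' = (ρ_δ θ)' e^{c₀t} + ρ_δ θ c₀ e^{c₀t}`. [folklore] -/
theorem hasDerivAt_timeProfile (c₀ δ t : ℝ) :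
    HasDerivAt (timeProfile c₀ δ)
      (deriv (fun s => rise δ s * fall s) t * Real.exp (c₀ * t) +
        rise δ t * fall t * (c₀ * Real.exp (c₀ * t))) t := by
  have h1 : HasDerivAt (fun s => rise δ s * fall s) (deriv (fun s => rise δ s * fall s) t) t := by
    have h : HasDerivAt (fun s => rise δ s * fall s)
        (deriv Real.smoothTransition ((t - 1 / 2) / δ) * (1 / δ) * fall t +
          rise δ t * (deriv Real.smoothTransition (4 * (1 - t)) * (-4))) t :=
      (hasDerivAt_rise δ t).mul (hasDerivAt_fall t)
    exact h.differentiableAt.hasDerivAt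
  have h2 : HasDerivAt (fun s => Real.exp (c₀ * s)) (Real.exp (c₀ * t) * (c₀ * 1)) t :=
    ((hasDerivAt_id t).const_mul c₀).exp
  have h := h1.mul h2
  refine h.congr_deriv ?_
  ring

/-- `G = 0` for `t ≤ 1/2`. [folklore] -/
theorem heatTest_eq_zero_of_le {c₀ ε δ : ℝ} {x₀ : E} (hδ : 0 < δ) {z : ℝ × E}
    (hz : z.1 ≤ 1 / 2) : heatTest c₀ ε δ x₀ z = 0 := by
  simp [heatTest, timeProfile_eq_zero_of_le hδ hz]

/-- `G(t, x) ≠ 0` forces `1/2 < t < 1` and `‖x₀ - x‖ < 5/8`. [folklore] -/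
theorem heatTest_ne_zero_imp {c₀ ε δ : ℝ} {x₀ : E} (hδ : 0 < δ) {z : ℝ × E}
    (h : heatTest c₀ ε δ x₀ z ≠ 0) : (1 / 2 < z.1 ∧ z.1 < 1) ∧ ‖x₀ - z.2‖ < 5 / 8 := by
  have h1 : timeProfile c₀ δ z.1 ≠ 0 := fun h0 => h (by rw [heatTest, h0, zero_mul])
  have h2 : spaceKernel (z.1 - 1 / 2 + ε) (x₀ - z.2) ≠ 0 := fun h0 => h (by
    rw [heatTest, h0, mul_zero])
  exact ⟨timeProfile_ne_zero_imp hδ h1, norm_lt_of_spaceKernel_ne_zero h2⟩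

/-- `tsupport G ⊆ [1/2, 1] × B̄(x₀, 5/8)`. [folklore] -/
theorem tsupport_heatTest_subset {c₀ ε δ : ℝ} {x₀ : E} (hδ : 0 < δ) :
    tsupport (heatTest c₀ ε δ x₀) ⊆ Icc (1 / 2 : ℝ) 1 ×ˢ closedBall x₀ (5 / 8) := by
  refine closure_minimal (fun z hz => ?_) (isClosed_Icc.prod isClosed_closedBall)
  obtain ⟨⟨h1, h2⟩, h3⟩ := heatTest_ne_zero_imp hδ (mem_support.1 hz)
  refine ⟨⟨h1.le, h2.le⟩, ?_⟩
  rw [mem_closedBall, dist_eq_norm, ← norm_sub_rev]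
  exact h3.le

/-- `G` has compact support. [folklore] -/
theorem hasCompactSupport_heatTest {c₀ ε δ : ℝ} {x₀ : E} (hδ : 0 < δ) :
    HasCompactSupport (heatTest c₀ ε δ x₀) :=
  (isCompact_Icc.prod (isCompact_closedBall _ _)).of_isClosed_subset (isClosed_tsupport _)
    (tsupport_heatTest_subset hδ)

/-- `G ≥ 0` (`ε, δ > 0`). [folklore] -/
theorem heatTest_nonneg {c₀ ε δ : ℝ} {x₀ : E} (hε : 0 < ε) (hδ : 0 < δ) (z : ℝ × E) :
    0 ≤ heatTest c₀ ε δ x₀ z := by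
  rcases le_or_gt z.1 (1 / 2) with h | h
  · rw [heatTest_eq_zero_of_le hδ h]
  · exact mul_nonneg (timeProfile_nonneg _ _ _) (spaceKernel_nonneg (by linarith) _)

/-- **`G` is smooth on `ℝ × E`**: on `{t > 1/2 - ε}` every factor is smooth (the kernel by
joint smoothness of `(s, y) ↦ Γ_s(y)` on `s > 0`), and `G` vanishes identically on `{t ≤ 1/2}`
(gluing). [folklore] -/
theorem contDiff_heatTest {c₀ ε δ : ℝ} {x₀ : E} (hε : 0 < ε) (hδ : 0 < δ) :
    ContDiff ℝ ∞ (heatTest c₀ ε δ x₀) := by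
  set Ω : Set (ℝ × E) := {z | 1 / 2 - ε < z.1} with hΩdef
  have hΩ : IsOpen Ω := isOpen_lt continuous_const continuous_fst
  have hK : IsClosed {z : ℝ × E | 1 / 2 ≤ z.1} := isClosed_le continuous_const continuous_fst
  have hKΩ : {z : ℝ × E | 1 / 2 ≤ z.1} ⊆ Ω := fun z hz => by
    have hz' : 1 / 2 ≤ z.1 := hz
    show 1 / 2 - ε < z.1
    linarith
  have hon : ContDiffOn ℝ ∞ (heatTest c₀ ε δ x₀) Ω := by
    have h1 : ContDiff ℝ ∞ fun z : ℝ × E => timeProfile c₀ δ z.1 :=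
      (contDiff_timeProfile c₀ δ).comp contDiff_fst
    have h2 : ContDiff ℝ ∞ fun z : ℝ × E => spaceCut (E := E) 1 (x₀ - z.2) :=
      (contDiff_spaceCut 1).comp (contDiff_const.sub contDiff_snd)
    have hmap : ContDiff ℝ ∞ fun z : ℝ × E => ((z.1 - 1 / 2 + ε, x₀ - z.2) : ℝ × E) :=
      ((contDiff_fst.sub contDiff_const).add contDiff_const).prodMk
        (contDiff_const.sub contDiff_snd)
    have hmaps : MapsTo (fun z : ℝ × E => ((z.1 - 1 / 2 + ε, x₀ - z.2) : ℝ × E)) Ω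
        (Ioi (0 : ℝ) ×ˢ univ) := fun z hz => by
      have hz' : 1 / 2 - ε < z.1 := hz
      refine ⟨?_, mem_univ _⟩
      show (0 : ℝ) < z.1 - 1 / 2 + ε
      linarith
    have h3 : ContDiffOn ℝ ∞ (fun z : ℝ × E => heatKernel (z.1 - 1 / 2 + ε) (x₀ - z.2)) Ω :=
      contDiffOn_uncurry_heatKernel.comp hmap.contDiffOn hmaps
    exact h1.contDiffOn.mul (h2.contDiffOn.mul h3)
  exact contDiff_of_contDiffOn_of_eq_zero hΩ hK hKΩ hon fun z hz =>
    heatTest_eq_zero_of_le hδ (le_of_not_ge hz)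

/-- `G` is `C²`. [folklore] -/
theorem contDiff_two_heatTest {c₀ ε δ : ℝ} {x₀ : E} (hε : 0 < ε) (hδ : 0 < δ) :
    ContDiff ℝ 2 (heatTest c₀ ε δ x₀) :=
  (contDiff_heatTest hε hδ).of_le (WithTop.coe_le_coe.2 le_top)

/-- The time slice of `G` and its derivative on `t > 1/2 - ε` (the kernel is caloric:
`∂ₛΓ_s = (‖y‖²/(4s²) - n/(2s)) Γ_s`). [folklore] -/
theorem hasDerivAt_heatTest_slice {c₀ ε δ : ℝ} {x₀ : E} {t : ℝ} (ht : 1 / 2 - ε < t) (x : E) :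
    HasDerivAt (fun s => heatTest c₀ ε δ x₀ (s, x))
      ((deriv (fun s => rise δ s * fall s) t * Real.exp (c₀ * t) +
          rise δ t * fall t * (c₀ * Real.exp (c₀ * t))) *
          spaceKernel (t - 1 / 2 + ε) (x₀ - x) +
        timeProfile c₀ δ t * (spaceCut 1 (x₀ - x) *
          ((‖x₀ - x‖ ^ 2 / (4 * (t - 1 / 2 + ε) ^ 2) -
            (Module.finrank ℝ E : ℝ) / (2 * (t - 1 / 2 + ε))) * heatKernel (t - 1 / 2 + ε) (x₀ - x))))
      t := by
  have hσ : 0 < t - 1 / 2 + ε := by linarith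
  set y := x₀ - x with hy
  have hin : HasDerivAt (fun s : ℝ => s - 1 / 2 + ε) 1 t := by
    simpa using ((hasDerivAt_id t).sub_const (1 / 2 : ℝ)).add_const ε
  have hK : HasDerivAt (fun s : ℝ => heatKernel (s - 1 / 2 + ε) y)
      (((‖y‖ ^ 2 / (4 * (t - 1 / 2 + ε) ^ 2) -
        (Module.finrank ℝ E : ℝ) / (2 * (t - 1 / 2 + ε))) * heatKernel (t - 1 / 2 + ε) y) * 1) t :=
    HasDerivAt.comp t (h₂ := fun s : ℝ => heatKernel s y) (hasDerivAt_heatKernel_time hσ y) hin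
  have h := (hasDerivAt_timeProfile c₀ δ t).mul (hK.const_mul (spaceCut (E := E) 1 y))
  refine h.congr_deriv ?_
  simp only [spaceKernel, mul_one]

/-- **The heat operator on `G`.** For `0 < ε` and `0 < δ ≤ 1/4`, everywhere on `ℝ × E`,

  `∂ₜG - ΔₓG - c₀G = ρ_δ' e^{c₀t} K + (θ' e^{c₀t} K - A R)`  (`= heatTestPos + heatTestRem`),

with `K`, `R` evaluated at `(t - 1/2 + ε, x₀ - x)`: the caloric terms `A φ ∂ₛΓ` and `A φ ΔΓ`
cancel, and `(ρ_δθ)' = ρ_δ' + θ'`. Here `∂ₜ = Carleman.dt`, `Δₓ = Carleman.lap`. [folklore] -/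
theorem dt_sub_lap_heatTest {c₀ ε δ : ℝ} {x₀ : E} (hε : 0 < ε) (hδ : 0 < δ) (hδ4 : δ ≤ 1 / 4)
    (z : ℝ × E) :
    dt (heatTest c₀ ε δ x₀) z - lap (heatTest c₀ ε δ x₀) z - c₀ * heatTest c₀ ε δ x₀ z =
      heatTestPos c₀ ε δ x₀ z + heatTestRem c₀ ε δ x₀ z := by
  obtain ⟨t, x⟩ := z
  have hH : ContDiff ℝ 2 (heatTest c₀ ε δ x₀) := contDiff_two_heatTest hε hδ
  rcases le_or_gt t (1 / 2 - ε) with ht | ht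
  · -- below `1/2 - ε < 1/2`: everything vanishes near `(t, x)`
    have ht2 : t < 1 / 2 := by linarith
    have hO : IsOpen {z : ℝ × E | z.1 < 1 / 2} := isOpen_lt continuous_fst continuous_const
    obtain ⟨h1, -, -, h4, -⟩ := frame_eq_of_eventuallyEq (W := heatTest c₀ ε δ x₀)
      (v := fun _ => (0 : ℝ)) hO (show ((t, x) : ℝ × E) ∈ {z : ℝ × E | z.1 < 1 / 2} from ht2)
      fun y hy => heatTest_eq_zero_of_le hδ (le_of_lt hy)
    have hdt0 : dt (fun _ : ℝ × E => (0 : ℝ)) (t, x) = 0 := by simp [dt_apply]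
    have hdx0 : ∀ e : E, dx e (fun _ : ℝ × E => (0 : ℝ)) = fun _ => 0 := fun e => by
      funext w
      simp [dx_apply]
    have hlap0 : lap (fun _ : ℝ × E => (0 : ℝ)) (t, x) = 0 := by simp [lap, hdx0]
    rw [h1, h4, hdt0, hlap0, heatTest_eq_zero_of_le hδ ht2.le]
    simp [heatTestPos, heatTestRem, deriv_rise_eq_zero_of_le hδ ht2.le,
      deriv_fall_eq_zero_of_le (show t ≤ 3 / 4 by linarith), timeProfile_eq_zero_of_le hδ ht2.le]
  · -- the formula region
    set σ := t - 1 / 2 + ε with hσdef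
    have hσ : 0 < σ := by rw [hσdef]; linarith
    set y := x₀ - x with hy
    -- time derivative
    have hdt : dt (heatTest c₀ ε δ x₀) (t, x) =
        (deriv (fun s => rise δ s * fall s) t * Real.exp (c₀ * t) +
            rise δ t * fall t * (c₀ * Real.exp (c₀ * t))) * spaceKernel σ y +
          timeProfile c₀ δ t * (spaceCut 1 y *
            ((‖y‖ ^ 2 / (4 * σ ^ 2) - (Module.finrank ℝ E : ℝ) / (2 * σ)) * heatKernel σ y)) := by
      rw [dt_apply, fderiv_apply_one_zero_eq_deriv_slice (hH.differentiable (by norm_num) _),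
        (hasDerivAt_heatTest_slice ht x).deriv]
    -- Laplacian
    have hlap : lap (heatTest c₀ ε δ x₀) (t, x) =
        timeProfile c₀ δ t * (spaceCut 1 y *
            ((‖y‖ ^ 2 / (4 * σ ^ 2) - (Module.finrank ℝ E : ℝ) / (2 * σ)) * heatKernel σ y) +
          kernelRem σ y) := by
      rw [lap_eq_laplacian_slice hH]
      have hslice : (fun x' => heatTest c₀ ε δ x₀ (t, x')) =
          (timeProfile c₀ δ t) • fun x' => spaceKernel σ (x₀ - x') := by
        funext x'
        rfl
      have hc : ContDiffAt ℝ 2 (fun x' => spaceKernel σ (x₀ - x')) x :=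
        ((contDiff_spaceKernel (m := 2) σ).comp (contDiff_const.sub contDiff_id)).contDiffAt
      rw [hslice, laplacian_smul _ hc, smul_eq_mul,
        laplacian_comp_sub_left (contDiff_spaceKernel σ) x₀ x, laplacian_spaceKernel]
    rw [hdt, hlap, deriv_rise_mul_fall hδ hδ4]
    simp only [heatTest, heatTestPos, heatTestRem, timeProfile, spaceKernel]
    ring

/-! ### The positive part: sign, support, lower bound near the pole, continuity -/

/-- `heatTestPos ≥ 0` (`ρ_δ' ≥ 0`, and `K_s ≥ 0` once `s > 0`, i.e. `t > 1/2 - ε`; below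
`t = 1/2` the factor `ρ_δ'` vanishes). [folklore] -/
theorem heatTestPos_nonneg {c₀ ε δ : ℝ} {x₀ : E} (hε : 0 < ε) (hδ : 0 < δ) (z : ℝ × E) :
    0 ≤ heatTestPos c₀ ε δ x₀ z := by
  rcases le_or_gt z.1 (1 / 2) with h | h
  · simp [heatTestPos, deriv_rise_eq_zero_of_le hδ h]
  · exact mul_nonneg (mul_nonneg (deriv_rise_nonneg hδ _) (Real.exp_pos _).le)
      (spaceKernel_nonneg (by linarith) _)

/-- `heatTestPos(t, x) ≠ 0` forces `1/2 < t < 1/2 + δ` and `‖x₀ - x‖ < 5/8`. [folklore] -/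
theorem heatTestPos_ne_zero_imp {c₀ ε δ : ℝ} {x₀ : E} (hδ : 0 < δ) {z : ℝ × E}
    (h : heatTestPos c₀ ε δ x₀ z ≠ 0) :
    (1 / 2 < z.1 ∧ z.1 < 1 / 2 + δ) ∧ ‖x₀ - z.2‖ < 5 / 8 := by
  have h1 : deriv (rise δ) z.1 ≠ 0 := fun h0 => h (by rw [heatTestPos, h0, zero_mul, zero_mul])
  have h2 : spaceKernel (z.1 - 1 / 2 + ε) (x₀ - z.2) ≠ 0 := fun h0 => h (by
    rw [heatTestPos, h0, mul_zero])
  exact ⟨⟨lt_of_not_ge fun h' => h1 (deriv_rise_eq_zero_of_le hδ h'),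
    lt_of_not_ge fun h' => h1 (deriv_rise_eq_zero_of_ge hδ h')⟩, norm_lt_of_spaceKernel_ne_zero h2⟩

/-- **Near the pole the positive part is the Gaussian times `ρ_δ'`**: for `c₀ ≥ 0`, `t ≥ 1/2`
and `‖x₀ - x‖ ≤ 1/2` (where `φ = 1` and `e^{c₀t} ≥ 1`),
`ρ_δ'(t) Γ_{t-1/2+ε}(x₀ - x) ≤ heatTestPos(t, x)`. [folklore] -/
theorem deriv_rise_mul_heatKernel_le_heatTestPos {c₀ ε δ : ℝ} {x₀ : E} (hc₀ : 0 ≤ c₀)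
    (hε : 0 < ε) (hδ : 0 < δ) {t : ℝ} (ht : 1 / 2 ≤ t) {x : E} (hx : ‖x₀ - x‖ ≤ 1 / 2) :
    deriv (rise δ) t * heatKernel (t - 1 / 2 + ε) (x₀ - x) ≤ heatTestPos c₀ ε δ x₀ (t, x) := by
  have hσ : 0 < t - 1 / 2 + ε := by linarith
  rw [heatTestPos, spaceKernel_eq_heatKernel hx]
  have h1 : 1 ≤ Real.exp (c₀ * t) := Real.one_le_exp (mul_nonneg hc₀ (by linarith))
  have h2 : 0 ≤ deriv (rise δ) t * heatKernel (t - 1 / 2 + ε) (x₀ - x) :=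
    mul_nonneg (deriv_rise_nonneg hδ _) (heatKernel_pos hσ _).le
  nlinarith [mul_le_mul_of_nonneg_left h1 h2]

/-- Joint continuity of `(t, x) ↦ K_{t-1/2+ε}(x₀ - x)` on `t > 1/2 - ε`. [folklore] -/
theorem continuousOn_spaceKernel_comp {ε : ℝ} (x₀ : E) :
    ContinuousOn (fun z : ℝ × E => spaceKernel (z.1 - 1 / 2 + ε) (x₀ - z.2))
      {z : ℝ × E | 1 / 2 - ε < z.1} := by
  have hmap : Continuous fun z : ℝ × E => ((z.1 - 1 / 2 + ε, x₀ - z.2) : ℝ × E) := by fun_prop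
  have hmaps : MapsTo (fun z : ℝ × E => ((z.1 - 1 / 2 + ε, x₀ - z.2) : ℝ × E))
      {z : ℝ × E | 1 / 2 - ε < z.1} (Ioi (0 : ℝ) ×ˢ univ) := fun z hz => by
    have hz' : 1 / 2 - ε < z.1 := hz
    refine ⟨?_, mem_univ _⟩
    show (0 : ℝ) < z.1 - 1 / 2 + ε
    linarith
  have hK : ContinuousOn (fun z : ℝ × E => heatKernel (z.1 - 1 / 2 + ε) (x₀ - z.2))
      {z : ℝ × E | 1 / 2 - ε < z.1} :=
    (contDiffOn_uncurry_heatKernel (m := 0)).continuousOn.comp hmap.continuousOn hmaps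
  exact (((contDiff_spaceCut (m := 0) 1).continuous.comp (continuous_const.sub
    continuous_snd)).continuousOn).mul hK

/-- Joint continuity of `(t, x) ↦ R_{t-1/2+ε}(x₀ - x)` on `t > 1/2 - ε`. [folklore] -/
theorem continuousOn_kernelRem_comp {ε : ℝ} (x₀ : E) :
    ContinuousOn (fun z : ℝ × E => kernelRem (z.1 - 1 / 2 + ε) (x₀ - z.2))
      {z : ℝ × E | 1 / 2 - ε < z.1} := by
  have hmap : Continuous fun z : ℝ × E => ((z.1 - 1 / 2 + ε, x₀ - z.2) : ℝ × E) := by fun_prop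
  have hmaps : MapsTo (fun z : ℝ × E => ((z.1 - 1 / 2 + ε, x₀ - z.2) : ℝ × E))
      {z : ℝ × E | 1 / 2 - ε < z.1} (Ioi (0 : ℝ) ×ˢ univ) := fun z hz => by
    have hz' : 1 / 2 - ε < z.1 := hz
    refine ⟨?_, mem_univ _⟩
    show (0 : ℝ) < z.1 - 1 / 2 + ε
    linarith
  have h := ContinuousOn.comp (g := fun p : ℝ × E => kernelRem p.1 p.2)
    (f := fun z : ℝ × E => ((z.1 - 1 / 2 + ε, x₀ - z.2) : ℝ × E)) continuousOn_kernelRem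
    hmap.continuousOn hmaps
  exact h

/-- `heatTestPos` is continuous on `ℝ × E` (`ε, δ > 0`). [folklore] -/
theorem continuous_heatTestPos {c₀ ε δ : ℝ} {x₀ : E} (hε : 0 < ε) (hδ : 0 < δ) :
    Continuous (heatTestPos c₀ ε δ x₀) := by
  have hΩ : IsOpen {z : ℝ × E | 1 / 2 - ε < z.1} := isOpen_lt continuous_const continuous_fst
  have hK : IsClosed {z : ℝ × E | 1 / 2 ≤ z.1} := isClosed_le continuous_const continuous_fst
  have hKΩ : {z : ℝ × E | 1 / 2 ≤ z.1} ⊆ {z : ℝ × E | 1 / 2 - ε < z.1} := fun z hz => by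
    have hz' : 1 / 2 ≤ z.1 := hz
    show 1 / 2 - ε < z.1
    linarith
  have hd : Continuous fun z : ℝ × E => deriv (rise δ) z.1 :=
    ((contDiff_rise (m := 1) δ).continuous_deriv le_rfl).comp continuous_fst
  have he : Continuous fun z : ℝ × E => Real.exp (c₀ * z.1) := by fun_prop
  refine continuous_of_continuousOn_of_eq_zero hΩ hK hKΩ
    ((hd.mul he).continuousOn.mul (continuousOn_spaceKernel_comp x₀)) fun z hz => ?_
  have hz' : z.1 ≤ 1 / 2 := le_of_not_ge hz
  simp [heatTestPos, deriv_rise_eq_zero_of_le hδ hz']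

/-! ### The bounded part: support, uniform bound, continuity -/

/-- `heatTestRem` is continuous on `ℝ × E` (`ε, δ > 0`). [folklore] -/
theorem continuous_heatTestRem {c₀ ε δ : ℝ} {x₀ : E} (hε : 0 < ε) (hδ : 0 < δ) :
    Continuous (heatTestRem c₀ ε δ x₀) := by
  have hΩ : IsOpen {z : ℝ × E | 1 / 2 - ε < z.1} := isOpen_lt continuous_const continuous_fst
  have hK : IsClosed {z : ℝ × E | 1 / 2 ≤ z.1} := isClosed_le continuous_const continuous_fst
  have hKΩ : {z : ℝ × E | 1 / 2 ≤ z.1} ⊆ {z : ℝ × E | 1 / 2 - ε < z.1} := fun z hz => by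
    have hz' : 1 / 2 ≤ z.1 := hz
    show 1 / 2 - ε < z.1
    linarith
  have hd : Continuous fun z : ℝ × E => deriv fall z.1 :=
    ((contDiff_fall (m := 1)).continuous_deriv le_rfl).comp continuous_fst
  have he : Continuous fun z : ℝ × E => Real.exp (c₀ * z.1) := by fun_prop
  have hA : Continuous fun z : ℝ × E => timeProfile c₀ δ z.1 :=
    (contDiff_timeProfile c₀ δ).continuous.comp continuous_fst
  refine continuous_of_continuousOn_of_eq_zero hΩ hK hKΩ
    (((hd.mul he).continuousOn.mul (continuousOn_spaceKernel_comp x₀)).sub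
      (hA.continuousOn.mul (continuousOn_kernelRem_comp x₀))) fun z hz => ?_
  have hz' : z.1 ≤ 1 / 2 := le_of_not_ge hz
  simp [heatTestRem, deriv_fall_eq_zero_of_le (show z.1 ≤ 3 / 4 by linarith),
    timeProfile_eq_zero_of_le hδ hz']

/-- **The bounded part is `O(e^{c₀})` and lives in the open cylinder.** There is `K = K(n) ≥ 0`
such that for `c₀ ≥ 0`, `0 < ε`, `0 < δ ≤ 1/4`, all `x₀` and all `(t, x)`:
`|heatTestRem(t, x)| ≤ e^{c₀} K`, and `heatTestRem(t, x) ≠ 0 ⟹ 1/2 < t < 1, ‖x - x₀‖ < 1`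
(`θ' ≠ 0` only for `3/4 < t < 1`, where `K_{t-1/2+ε} ≤ 1`; `A ≤ e^{c₀t}`; `|R| ≤ K_R` on its
annulus). [folklore] -/
theorem exists_abs_heatTestRem_le :
    ∃ K : ℝ, 0 ≤ K ∧ ∀ (c₀ ε δ : ℝ) (x₀ : E), 0 ≤ c₀ → 0 < ε → 0 < δ → δ ≤ 1 / 4 →
      ∀ z : ℝ × E, |heatTestRem c₀ ε δ x₀ z| ≤ Real.exp c₀ * K ∧
        (heatTestRem c₀ ε δ x₀ z ≠ 0 → z ∈ Ioo (1 / 2 : ℝ) 1 ×ˢ ball x₀ 1) := by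
  obtain ⟨D, hD0, hD⟩ := exists_abs_deriv_fall_le
  obtain ⟨KR, hKR0, hKR⟩ := exists_abs_kernelRem_le (E := E)
  refine ⟨D + KR, by positivity, fun c₀ ε δ x₀ hc₀ hε hδ hδ4 z => ?_⟩
  obtain ⟨t, x⟩ := z
  have hexp : ∀ {s : ℝ}, s ≤ 1 → Real.exp (c₀ * s) ≤ Real.exp c₀ := fun hs =>
    Real.exp_le_exp.2 (by nlinarith)
  -- first term
  have h1 : |deriv fall t * Real.exp (c₀ * t) * spaceKernel (t - 1 / 2 + ε) (x₀ - x)| ≤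
      Real.exp c₀ * D ∧ (deriv fall t * Real.exp (c₀ * t) * spaceKernel (t - 1 / 2 + ε) (x₀ - x)
        ≠ 0 → (1 / 2 < t ∧ t < 1) ∧ ‖x₀ - x‖ < 5 / 8) := by
    rcases eq_or_ne (deriv fall t) 0 with h0 | h0
    · simp only [h0, zero_mul, abs_zero, ne_eq, not_true_eq_false, false_imp_iff, and_true]
      positivity
    · have ht1 : 3 / 4 < t := lt_of_not_ge fun h' => h0 (deriv_fall_eq_zero_of_le h')
      have ht2 : t < 1 := lt_of_not_ge fun h' => h0 (deriv_fall_eq_zero_of_ge h')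
      have hσ : 1 / 4 ≤ t - 1 / 2 + ε := by linarith
      have hK0 : 0 ≤ spaceKernel (t - 1 / 2 + ε) (x₀ - x) := spaceKernel_nonneg (by linarith) _
      have hK1 : spaceKernel (t - 1 / 2 + ε) (x₀ - x) ≤ 1 := spaceKernel_le_one hσ _
      refine ⟨?_, fun hne => ⟨⟨by linarith, ht2⟩, ?_⟩⟩
      · rw [abs_mul, abs_mul, abs_of_nonneg (Real.exp_pos _).le, abs_of_nonneg hK0]
        calc |deriv fall t| * Real.exp (c₀ * t) * spaceKernel (t - 1 / 2 + ε) (x₀ - x)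
            ≤ D * Real.exp c₀ * 1 := by
              refine mul_le_mul (mul_le_mul (hD t) (hexp ht2.le) (Real.exp_pos _).le hD0) hK1
                hK0 (by positivity)
          _ = Real.exp c₀ * D := by ring
      · exact norm_lt_of_spaceKernel_ne_zero fun h' => hne (by rw [h', mul_zero])
  -- second term
  have h2 : |timeProfile c₀ δ t * kernelRem (t - 1 / 2 + ε) (x₀ - x)| ≤ Real.exp c₀ * KR ∧
      (timeProfile c₀ δ t * kernelRem (t - 1 / 2 + ε) (x₀ - x) ≠ 0 →
        (1 / 2 < t ∧ t < 1) ∧ ‖x₀ - x‖ ≤ 5 / 8) := by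
    rcases eq_or_ne (timeProfile c₀ δ t) 0 with h0 | h0
    · simp only [h0, zero_mul, abs_zero, ne_eq, not_true_eq_false, false_imp_iff, and_true]
      positivity
    · obtain ⟨ht1, ht2⟩ := timeProfile_ne_zero_imp hδ h0
      have hσ : 0 < t - 1 / 2 + ε := by linarith
      obtain ⟨hb, hsupp⟩ := hKR _ hσ (x₀ - x)
      refine ⟨?_, fun hne => ⟨⟨ht1, ht2⟩, (hsupp fun h' => hne (by rw [h', mul_zero])).2⟩⟩
      rw [abs_mul, abs_of_nonneg (timeProfile_nonneg _ _ _)]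
      exact mul_le_mul ((timeProfile_le_exp _ _ _).trans (hexp ht2.le)) hb (abs_nonneg _)
        (Real.exp_pos _).le
  refine ⟨?_, fun hne => ?_⟩
  · rw [heatTestRem]
    refine (abs_sub _ _).trans ?_
    rw [mul_add]
    exact add_le_add h1.1 h2.1
  · rw [heatTestRem] at hne
    have hx : ∀ {a : ℝ}, ‖x₀ - x‖ < a → x ∈ ball x₀ a := fun h => by
      rwa [mem_ball, dist_eq_norm, ← norm_sub_rev]
    by_cases hA : deriv fall t * Real.exp (c₀ * t) * spaceKernel (t - 1 / 2 + ε) (x₀ - x) = 0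
    · rw [hA, zero_sub, neg_ne_zero] at hne
      obtain ⟨ht, hx'⟩ := h2.2 hne
      exact ⟨ht, hx (by linarith)⟩
    · obtain ⟨ht, hx'⟩ := h1.2 hA
      exact ⟨ht, hx (by linarith)⟩

end TestFn

end Carleman

end Literature.Analysis.FluidPDE
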